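import Mathlib
import Summits.NavierStokesRegularity.NavierStokesRegularity.Theorems.EulerZoomLiouvillePowerGaugeEulerLiouvilleSelfSimilarSwirlPiercing
import Literature.Analysis.FluidPDE.AxisymSwirlGradientCurl
import HarnessLib

/-!
# Crux E `PowerGaugeEulerLiouville` (stmt-NavierStokesRegularity-19832), THE ONE STATEMENT: swirl points are VORTICAL, and the INFLOW RATE at a swirl maximum
# (sequel to `…SelfSimilarSwirlPiercing`; width seat ns-ezl-w3 g3)

Route №10 `EulerZoomLiouville` (NavierStokesRegularity), crux E; LEAD ns-typeII-p2 g12.  Two more portrait facts for the axisymmetric residue (N4′), no growth /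
tameness / pressure hypothesis:

* `curl_ne_zero_of_swirl_ne_zero` — **the swirl set lies inside the vortical set**: MB (2.64) in Cartesian form (`IsAxisymmetric.fderiv_swirl_apply_eq_curl`:
  `DΓ(x)h = ω₂(x)(x₀h₀ + x₁h₁) − (x₀ω₀ + x₁ω₁)h₂`) makes `DΓ(x) = 0` wherever `curl V(x) = 0`, while the ratchet `DΓ(x)[W(x)] = −(1−2γ)Γ(x)` is non-zero at swirl
  points (`γ < ½`).  Hence the fast-inflow swirl maxima of `swirl_piercing` are VORTICAL (`swirl_piercing_vortical`): on every sphere beyond the swirl onset the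
  axisymmetric needle carries a vortical fast-inflow point — the (N1) point of the portrait, located at the swirl maximum.
* `swirlMax_inflow_rate` — at a ball maximum `a` of `Γ²` (`‖a‖ = R`, `Γ(a) ≠ 0`): `Γ(a)·DΓ(a)[a] > 0` (the swirl modulus increases radially there) and the EXACT RATE LAW
  `⟪a, W(a)⟫ · DΓ(a)[a] = −(1−2γ) R² Γ(a)`, i.e. inflow rate `−⟪a,W⟫/R² = (1−2γ)/(R ∂_R log|Γ|)(a)`: the swirl channel is FAST (rate `> c₁`) exactly where the
  radial log-slope of the maximal swirl is `< (1−2γ)/c₁` (Fermat on the ball: `D(Γ²)(a) = λ⟨a,·⟩`, `λ ≥ 0`, evaluated on `a` and on `W(a)`).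

WHAT THIS IS NOT: not NS regularity, not the crux E, not a kill — portrait lemmas for the registered residue of the crux CLASS 19832 (MODEL lattice; E/NS strata),
`--supports` stmt-19832; 19832 OPEN. [cite: MajdaBertozziCUP2002, §2.3.3 eq. (2.64); Chae2007CMPEuler, Thm 2.2 + Note added p. 6]
-/

noncomputable section

-- flat `Theorems/<Route><Decl>…` files of one crux share the namespace of the crux (tree convention: `Summit.<S>.<S>.…`)
set_option linter.dupNamespace false

open MeasureTheory Set Filter Topology Metric Function InnerProductSpace
open scoped RealInnerProductSpace NNReal ContDiff

namespace Summit.NavierStokesRegularity.NavierStokesRegularity.Theorems.PowerGaugeEulerLiouville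

open Literature.Analysis Literature.Analysis.FluidPDE Literature.Analysis.FunctionSpaces

namespace SwirlRatchet

variable {γ : ℝ} {U : EuclideanSpace ℝ (Fin 3) → EuclideanSpace ℝ (Fin 3)} {P : EuclideanSpace ℝ (Fin 3) → ℝ}

/-- **SWIRL POINTS ARE VORTICAL**: for an axisymmetric `C²` self-similar profile with `γ < ½`, `Γ(y) ≠ 0 ⇒ curl U(y) ≠ 0` (`DΓ(y)` is built from `curl U(y)` by
MB (2.64), and `DΓ(y)[W(y)] = −(1−2γ)Γ(y) ≠ 0`). [cite: MajdaBertozziCUP2002, §2.3.3 eq. (2.64)] -/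
theorem curl_ne_zero_of_swirl_ne_zero (h : IsSelfSimilarEulerProfile γ 0 U P) (hU : IsAxisymmetric U) (hγ2 : γ < 1 / 2)
    {y : EuclideanSpace ℝ (Fin 3)} (hy : swirl U y ≠ 0) : curl U y ≠ 0 := by
  intro h0
  have hd : DifferentiableAt ℝ U y := (h.differentiable_velocity) y
  have h1 := hU.fderiv_swirl_apply_eq_curl hd (selfSimilarTransport γ 0 U y)
  rw [fderiv_swirl_transport h hU y, h0] at h1
  have h2 : -((1 - 2 * γ) * swirl U y) = 0 := by rw [h1]; simp
  rcases mul_eq_zero.1 (neg_eq_zero.1 h2) with h3 | h3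
  · linarith
  · exact hy h3

/-- **SWIRL PIERCING, VORTICAL FORM**: on every sphere beyond the swirl onset, a VORTICAL fast-inflow point (`⟪a, U a⟫ < −γR²`, `curl U a ≠ 0`) at which `|rU_θ|` is
maximal over the ball — the (N1) point of the needle portrait sits at the swirl maximum. [cite: Chae2007CMPEuler, Thm 2.2 + Note added p. 6] -/
theorem swirl_piercing_vortical (h : IsSelfSimilarEulerProfile γ 0 U P) (hU : IsAxisymmetric U) (hγ0 : 0 ≤ γ) (hγ2 : γ < 1 / 2)
    (hsw : ¬ HasNoSwirl U) :
    ∃ R₁ : ℝ, ∀ R : ℝ, R₁ ≤ R → ∃ a : EuclideanSpace ℝ (Fin 3), ‖a‖ = R ∧ swirl U a ≠ 0 ∧ curl U a ≠ 0 ∧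
      (∀ y ∈ closedBall (0 : EuclideanSpace ℝ (Fin 3)) R, |swirl U y| ≤ |swirl U a|) ∧
      ⟪a, selfSimilarTransport γ 0 U a⟫ < 0 ∧ ⟪a, U a⟫ < -(γ * R ^ 2) ∧ γ * R < ‖U a‖ := by
  obtain ⟨R₁, hR₁⟩ := swirl_piercing h hU hγ0 hγ2 hsw
  refine ⟨R₁, fun R hR => ?_⟩
  obtain ⟨a, haR, hΓ, hmax, hin, hUa, hnorm⟩ := hR₁ R hR
  exact ⟨a, haR, hΓ, curl_ne_zero_of_swirl_ne_zero h hU hγ2 hΓ, hmax, hin, hUa, hnorm⟩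

/-- **THE INFLOW RATE AT A SWIRL MAXIMUM.**  If `a` maximises `Γ²` over the closed ball `‖y‖ ≤ R` and `Γ(a) ≠ 0` (so `‖a‖ = R`, `⟪a, W(a)⟫ < 0` by
`swirlMax_boundary_inflow`), then `Γ(a)·DΓ(a)[a] > 0` and `⟪a, W(a)⟫ · DΓ(a)[a] = −(1−2γ) R² Γ(a)` — the inflow rate `−⟪a,W(a)⟫/R²` is `(1−2γ) Γ(a)/DΓ(a)[a]`,
the reciprocal of the radial log-slope of the swirl at its maximum.  (Fermat on the ball: `D(Γ²)(a)` vanishes on `a^⊥`; decompose `a` and `W(a)`.) [folklore] -/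
theorem swirlMax_inflow_rate (h : IsSelfSimilarEulerProfile γ 0 U P) (hU : IsAxisymmetric U) (hγ2 : γ < 1 / 2)
    {R : ℝ} {a : EuclideanSpace ℝ (Fin 3)} (ha : a ∈ closedBall (0 : EuclideanSpace ℝ (Fin 3)) R)
    (hmax : IsMaxOn (fun y => swirl U y ^ 2) (closedBall (0 : EuclideanSpace ℝ (Fin 3)) R) a) (hΓ : swirl U a ≠ 0) :
    0 < swirl U a * fderiv ℝ (swirl U) a a ∧
      ⟪a, selfSimilarTransport γ 0 U a⟫ * fderiv ℝ (swirl U) a a = -((1 - 2 * γ) * R ^ 2 * swirl U a) := by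
  obtain ⟨hR, hinflow⟩ := swirlMax_boundary_inflow h hU hγ2 ha hmax hΓ
  have hΓd : Differentiable ℝ (swirl U) := (contDiff_swirl h.contDiff_velocity).differentiable (by norm_num)
  set L : EuclideanSpace ℝ (Fin 3) →L[ℝ] ℝ := fderiv ℝ (swirl U) a with hL
  set f' : EuclideanSpace ℝ (Fin 3) →L[ℝ] ℝ := (2 * swirl U a) • L with hf'
  have hf : HasFDerivAt (fun y => swirl U y ^ 2) f' a := by
    have h1 := (hΓd a).hasFDerivAt.pow 2
    simpa [hf', hL, pow_one] using h1
  have hf'ap : ∀ v, f' v = 2 * swirl U a * L v := fun v => by rw [hf']; rfl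
  set Wa : EuclideanSpace ℝ (Fin 3) := selfSimilarTransport γ 0 U a with hWa
  have hLW : L Wa = -((1 - 2 * γ) * swirl U a) := fderiv_swirl_transport h hU a
  have hloc : IsLocalMaxOn (fun y => swirl U y ^ 2) (closedBall (0 : EuclideanSpace ℝ (Fin 3)) R) a := hmax.localize
  have hin : ∀ v : EuclideanSpace ℝ (Fin 3), ⟪v, a⟫ < 0 → f' v ≤ 0 := by
    intro v hv
    obtain ⟨t, ht0, htv⟩ := exists_smul_mem_posTangentConeAt_closedBall ha hv
    have h1 := hloc.hasFDerivWithinAt_nonpos hf.hasFDerivWithinAt htv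
    rw [map_smul, smul_eq_mul] at h1
    exact nonpos_of_mul_nonpos_right h1 ht0
  have ha0 : a ≠ 0 := by
    intro h0; apply hΓ; rw [h0]; simp [swirl]
  have hR0 : 0 < R := by rw [← hR]; exact norm_pos_iff.2 ha0
  have haa : ⟪a, a⟫ = R ^ 2 := by rw [real_inner_self_eq_norm_sq, hR]
  have hfa : 0 ≤ f' a := by
    have h1 := hin (-a) (by rw [inner_neg_left, haa]; linarith [pow_pos hR0 2])
    rw [map_neg] at h1
    linarith
  have hperp : ∀ v : EuclideanSpace ℝ (Fin 3), ⟪v, a⟫ = 0 → f' v = 0 := by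
    have hle : ∀ v : EuclideanSpace ℝ (Fin 3), ⟪v, a⟫ = 0 → f' v ≤ 0 := by
      intro v hv
      have hε : ∀ ε : ℝ, 0 < ε → f' v ≤ ε * f' a := by
        intro ε hε
        have h1 := hin (v - ε • a) (by rw [inner_sub_left, real_inner_smul_left, hv, haa]; nlinarith [pow_pos hR0 2])
        rw [map_sub, map_smul, smul_eq_mul] at h1
        linarith
      refine le_of_not_gt fun hpos => ?_
      have h2 := hε (f' v / (2 * (f' a + 1))) (by positivity)
      have h3 : f' v / (2 * (f' a + 1)) * f' a < f' v := by
        rw [div_mul_eq_mul_div, div_lt_iff₀ (by positivity)]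
        nlinarith
      linarith
    intro v hv
    refine le_antisymm (hle v hv) ?_
    have h1 := hle (-v) (by rw [inner_neg_left, hv, neg_zero])
    rw [map_neg] at h1
    linarith
  -- decompose `W(a)` along `a` and `a^⊥`
  set c : ℝ := ⟪a, Wa⟫ / R ^ 2 with hc
  have hcR : c * R ^ 2 = ⟪a, Wa⟫ := by rw [hc]; field_simp
  have hperpW : ⟪Wa - c • a, a⟫ = 0 := by
    rw [inner_sub_left, real_inner_smul_left, haa, hcR, real_inner_comm, sub_self]
  have hdecomp : f' Wa = c * f' a := by
    have h1 := hperp _ hperpW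
    rw [map_sub, map_smul, smul_eq_mul] at h1
    linarith
  -- `f' Wa < 0`, hence `f' a > 0` (as `c < 0 ≤ ...` would not do: use the sign of `c` from the inflow)
  have hΓ2 : 0 < swirl U a ^ 2 := by positivity
  have hfW : f' Wa = -(2 * (1 - 2 * γ) * swirl U a ^ 2) := by rw [hf'ap, hLW]; ring
  have hfWneg : f' Wa < 0 := by
    rw [hfW]
    have : 0 < 1 - 2 * γ := by linarith
    nlinarith
  have hc0 : c < 0 := by rw [hc]; exact div_neg_of_neg_of_pos hinflow (by positivity)
  have hfapos : 0 < f' a := by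
    rcases hfa.lt_or_eq with hlt | heq
    · exact hlt
    · rw [← heq, mul_zero] at hdecomp; rw [hdecomp] at hfWneg; exact absurd hfWneg (lt_irrefl 0)
  refine ⟨?_, ?_⟩
  · have : f' a = 2 * (swirl U a * L a) := by rw [hf'ap]; ring
    rw [this] at hfapos
    linarith
  · -- `⟪a, W⟫ · L a = c R² · L a`, and `2Γ c L a = c f' a = f' Wa = −2(1−2γ)Γ²`
    have h1 : c * (2 * swirl U a * L a) = -(2 * (1 - 2 * γ) * swirl U a ^ 2) := by rw [← hf'ap, ← hdecomp, hfW]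
    have h2 : ⟪a, Wa⟫ * L a = c * R ^ 2 * L a := by rw [hcR]
    rw [h2]
    have h3 : swirl U a * (c * L a) = -((1 - 2 * γ) * swirl U a ^ 2) := by nlinarith
    have h4 : c * L a = -((1 - 2 * γ) * swirl U a) := by
      have := mul_left_cancel₀ hΓ (h3.trans (by ring : -((1 - 2 * γ) * swirl U a ^ 2) = swirl U a * (-((1 - 2 * γ) * swirl U a))))
      exact this
    calc c * R ^ 2 * L a = R ^ 2 * (c * L a) := by ring
      _ = -((1 - 2 * γ) * R ^ 2 * swirl U a) := by rw [h4]; ring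

end SwirlRatchet

end Summit.NavierStokesRegularity.NavierStokesRegularity.Theorems.PowerGaugeEulerLiouville

end
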